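import Literature.Computability.MetaComplexity.Resolution
import Literature.Computability.Complexity.NegationElimination
import HarnessLib

/-!
# Feasible (monotone) interpolation for resolution

Krajíček's and Pudlák's *feasible interpolation theorem* for the resolution system `R`
(Krajíček 1997, Thm. 6.1; Pudlák 1997, Thm. 1), in the monotone form that yields lower bounds
from monotone circuit complexity.

Variables are split into three sorts, `X ⊕ (Y ⊕ Z)`: the SHARED variables `x : X` and the private
variables `y : Y` of a CNF `A(x, y)` and `z : Z` of a CNF `B(x, z)`.  Suppose the shared variables
occur only POSITIVELY in `A` (`ResInterpolant.cntA`) and `π` is a resolution refutation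
(`IsResRefutation`, with the weakening rule) of `A ++ B`.  Then there is a Boolean function
`I : (X → Bool) → Bool` of the shared variables — an *interpolant* — such that

* `I a = false` implies that `A(a, y)` is unsatisfiable, `I a = true` implies that `B(a, z)` is
  unsatisfiable (`ResInterpolant.SatOver`), and
* `I` is constant, or is computed by a MONOTONE circuit over `{∧₂, ∨₂}` (`monotoneBasis` of
  `Circuit.lean`) with at most `2 · |π|` gates

(`resolution_monotone_interpolation`).  The disjunct "constant" only reflects that the tree's
monotone basis has no constant gates; it is excluded as soon as both `A(a, ·)` and `B(a', ·)` are
satisfiable for some `a, a'` (`resolution_monotone_interpolation'`).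

## The construction (Pudlák 1997, proof of Thm. 1, "splitting" a refutation)

Fix `a : X → Bool`.  Every line `C` of `π` gets a TYPE bit `t(C)` (`false` = "comes from `A`",
`true` = "comes from `B`") with the semantic invariant (`ResInterpolant.SemA` / `SemB`):
if `t(C) = false` then every assignment extending `a` and satisfying `A` satisfies a literal of
`C` that is a `y`-literal or a POSITIVE `x`-literal; if `t(C) = true` then every assignment
extending `a` and satisfying `B` satisfies an `x`- or `z`-literal of `C`.  Initial clauses of
`A` get `false`, the other initial clauses `true`; weakening copies; a resolution step on a
`y`-pivot takes `t₁ ∨ t₂`, on a `z`-pivot `t₁ ∧ t₂`, and on an `x`-pivot `x` (premise `1`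
containing `x`, premise `2` containing `¬x`) takes `t₂ ∧ (a x ∨ t₁)` — monotone in `a` because a
negative `x`-literal never counts on the `A`-side.  At the empty clause the invariant says that
`A(a, ·)` resp. `B(a, ·)` is unsatisfiable.  The type bits ARE the wires of a straight-line
program over `{∧₂, ∨₂, 0, 1}` with two gates per proof line (`ResInterpolant.gates`), so the
interpolant is literally a gate value (`ResInterpolant.interp`); constants are then eliminated by
`GateList.const_or_exists_monotone_circuit` (`NegationElimination.lean`).

## References

* J. Krajíček, *Interpolation theorems, lower bounds for proof systems, and independence
  results for bounded arithmetic*, J. Symbolic Logic 62 (1997) 457–486, Thm. 6.1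
  [Krajicek1997].
* P. Pudlák, *Lower bounds for resolution and cutting plane proofs and monotone computations*,
  J. Symbolic Logic 62 (1997) 981–998, Thm. 1 [Pudlak1997].
* J. Krajíček, *Proof complexity* (CUP 2019), §17.6 (splitting proofs) and Chapter 18
  [KrajicekProofComplexity2019].

Not here: the general (non-monotone) interpolant by circuits with selector gates (same proof,
basis `B₂`); interpolation for cutting planes (Pudlák 1997, Thm. 3, monotone REAL circuits);
the application to clique–colouring formulas (`CliqueColouringResolutionLowerBound.lean`).
-/

namespace Literature.Computability.MetaComplexity

open Literature.Computability.Complexity GateList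

variable {X Y Z : Type*}

namespace ResInterpolant

/-! ### Sorts of literals -/

/-- A literal COUNTS ON THE `A`-SIDE if it is a positive shared literal `x` or a `y`-literal
(Pudlák 1997, proof of Thm. 1: negative occurrences of shared variables are attributed to `B`).
[cite: Pudlak1997, Thm. 1 (proof)] -/
def cntA : Literal (X ⊕ (Y ⊕ Z)) → Bool
  | (Sum.inl _, b) => b
  | (Sum.inr (Sum.inl _), _) => true
  | (Sum.inr (Sum.inr _), _) => false

/-- A literal COUNTS ON THE `B`-SIDE if it is a shared literal (either sign) or a `z`-literal.
[cite: Pudlak1997, Thm. 1 (proof)] -/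
def cntB : Literal (X ⊕ (Y ⊕ Z)) → Bool
  | (Sum.inl _, _) => true
  | (Sum.inr (Sum.inl _), _) => false
  | (Sum.inr (Sum.inr _), _) => true

/-- `cntA` on a shared literal is its sign. [folklore] -/
@[simp] theorem cntA_inl (x : X) (b : Bool) : cntA ((Sum.inl x, b) : Literal (X ⊕ (Y ⊕ Z))) = b := by
  cases b <;> rfl

/-- `cntA` holds on `y`-literals. [folklore] -/
@[simp] theorem cntA_inr_inl (y : Y) (b : Bool) :
    cntA ((Sum.inr (Sum.inl y), b) : Literal (X ⊕ (Y ⊕ Z))) = true := rfl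

/-- `cntA` fails on `z`-literals. [folklore] -/
@[simp] theorem cntA_inr_inr (z : Z) (b : Bool) :
    cntA ((Sum.inr (Sum.inr z), b) : Literal (X ⊕ (Y ⊕ Z))) = false := rfl

/-- `cntB` holds on shared literals. [folklore] -/
@[simp] theorem cntB_inl (x : X) (b : Bool) : cntB ((Sum.inl x, b) : Literal (X ⊕ (Y ⊕ Z))) = true := rfl

/-- `cntB` fails on `y`-literals. [folklore] -/
@[simp] theorem cntB_inr_inl (y : Y) (b : Bool) :
    cntB ((Sum.inr (Sum.inl y), b) : Literal (X ⊕ (Y ⊕ Z))) = false := rfl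

/-- `cntB` holds on `z`-literals. [folklore] -/
@[simp] theorem cntB_inr_inr (z : Z) (b : Bool) :
    cntB ((Sum.inr (Sum.inr z), b) : Literal (X ⊕ (Y ⊕ Z))) = true := rfl

/-! ### Semantics relative to a fixed assignment of the shared variables -/

/-- `SatOver F a`: the CNF `F` is satisfiable by a total assignment extending `a` on the shared
variables, i.e. `F(a, ·)` is satisfiable. [cite: Pudlak1997, Thm. 1] -/
def SatOver (F : CNF (X ⊕ (Y ⊕ Z))) (a : X → Bool) : Prop :=
  ∃ σ : X ⊕ (Y ⊕ Z) → Bool, (∀ x, σ (Sum.inl x) = a x) ∧ F.eval σ = true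

/-- The `A`-side invariant of a clause `C` under the shared assignment `a`: every assignment
extending `a` that satisfies `A` satisfies some literal of `C` counting on the `A`-side.
[cite: Pudlak1997, Thm. 1 (proof)] -/
def SemA (A : CNF (X ⊕ (Y ⊕ Z))) (a : X → Bool) (C : Finset (Literal (X ⊕ (Y ⊕ Z)))) : Prop :=
  ∀ σ : X ⊕ (Y ⊕ Z) → Bool, (∀ x, σ (Sum.inl x) = a x) → A.eval σ = true →
    ∃ l ∈ C, cntA l = true ∧ l.eval σ = true

/-- The `B`-side invariant of a clause `C` under the shared assignment `a`: every assignment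
extending `a` that satisfies `B` satisfies some literal of `C` counting on the `B`-side.
[cite: Pudlak1997, Thm. 1 (proof)] -/
def SemB (B : CNF (X ⊕ (Y ⊕ Z))) (a : X → Bool) (C : Finset (Literal (X ⊕ (Y ⊕ Z)))) : Prop :=
  ∀ σ : X ⊕ (Y ⊕ Z) → Bool, (∀ x, σ (Sum.inl x) = a x) → B.eval σ = true →
    ∃ l ∈ C, cntB l = true ∧ l.eval σ = true

section Semantics

variable {A B : CNF (X ⊕ (Y ⊕ Z))} {a : X → Bool}

/-- The `A`-side invariant is monotone under weakening. [folklore] -/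
theorem SemA.mono {C D : Finset (Literal (X ⊕ (Y ⊕ Z)))} (h : SemA A a C) (hCD : C ⊆ D) :
    SemA A a D := fun σ hσ hA => by
  obtain ⟨l, hl, h1, h2⟩ := h σ hσ hA
  exact ⟨l, hCD hl, h1, h2⟩

/-- The `B`-side invariant is monotone under weakening. [folklore] -/
theorem SemB.mono {C D : Finset (Literal (X ⊕ (Y ⊕ Z)))} (h : SemB B a C) (hCD : C ⊆ D) :
    SemB B a D := fun σ hσ hB => by
  obtain ⟨l, hl, h1, h2⟩ := h σ hσ hB
  exact ⟨l, hCD hl, h1, h2⟩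

/-- At the empty clause the `A`-side invariant says that `A(a, ·)` is unsatisfiable. [folklore] -/
theorem SemA.not_satOver (h : SemA A a ∅) : ¬ SatOver A a := by
  rintro ⟨σ, hσ, hA⟩
  obtain ⟨l, hl, -⟩ := h σ hσ hA
  simp at hl

/-- At the empty clause the `B`-side invariant says that `B(a, ·)` is unsatisfiable. [folklore] -/
theorem SemB.not_satOver (h : SemB B a ∅) : ¬ SatOver B a := by
  rintro ⟨σ, hσ, hB⟩
  obtain ⟨l, hl, -⟩ := h σ hσ hB
  simp at hl

/-- A satisfied CNF satisfies each of its set-clauses. [folklore] -/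
theorem exists_mem_eval_of_mem_clauseFinsets [DecidableEq X] [DecidableEq Y] [DecidableEq Z]
    {F : CNF (X ⊕ (Y ⊕ Z))} {σ : X ⊕ (Y ⊕ Z) → Bool} (hF : F.eval σ = true)
    {C : Finset (Literal (X ⊕ (Y ⊕ Z)))} (hC : C ∈ F.clauseFinsets) :
    ∃ l ∈ C, l.eval σ = true := by
  unfold CNF.clauseFinsets at hC
  obtain ⟨c, hc, rfl⟩ := List.mem_map.1 hC
  have hc' : c.any (Literal.eval σ) = true := by
    unfold CNF.eval at hF
    exact List.all_eq_true.1 hF c hc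
  obtain ⟨l, hl, hle⟩ := List.any_eq_true.1 hc'
  exact ⟨l, List.mem_toFinset.2 hl, hle⟩

/-- Initial clauses of `A` satisfy the `A`-side invariant (all their literals count on the
`A`-side). [cite: Pudlak1997, Thm. 1 (proof)] -/
theorem semA_initial [DecidableEq X] [DecidableEq Y] [DecidableEq Z]
    (hA : ∀ c ∈ A, ∀ l ∈ c, cntA l = true) {C : Finset (Literal (X ⊕ (Y ⊕ Z)))}
    (hC : C ∈ A.clauseFinsets) : SemA A a C := by
  intro σ _ hAσ
  obtain ⟨l, hl, hle⟩ := exists_mem_eval_of_mem_clauseFinsets hAσ hC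
  unfold CNF.clauseFinsets at hC
  obtain ⟨c, hc, rfl⟩ := List.mem_map.1 hC
  exact ⟨l, hl, hA c hc l (List.mem_toFinset.1 hl), hle⟩

/-- Initial clauses of `B` satisfy the `B`-side invariant. [cite: Pudlak1997, Thm. 1 (proof)] -/
theorem semB_initial [DecidableEq X] [DecidableEq Y] [DecidableEq Z]
    (hB : ∀ c ∈ B, ∀ l ∈ c, cntB l = true) {C : Finset (Literal (X ⊕ (Y ⊕ Z)))}
    (hC : C ∈ B.clauseFinsets) : SemB B a C := by
  intro σ _ hBσ
  obtain ⟨l, hl, hle⟩ := exists_mem_eval_of_mem_clauseFinsets hBσ hC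
  unfold CNF.clauseFinsets at hC
  obtain ⟨c, hc, rfl⟩ := List.mem_map.1 hC
  exact ⟨l, hl, hB c hc l (List.mem_toFinset.1 hl), hle⟩

variable [DecidableEq X] [DecidableEq Y] [DecidableEq Z]

/-- `x`-pivot, conclusion of type `A` from a type-`A` premise containing `¬x`: the negative
shared literal never counts on the `A`-side, whatever `a x` is.
[cite: Pudlak1997, Thm. 1 (proof)] -/
theorem SemA.erase_neg_inl {D : Finset (Literal (X ⊕ (Y ⊕ Z)))} (h : SemA A a D) (x : X) :
    SemA A a (D.erase (Sum.inl x, false)) := by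
  intro σ hσ hAσ
  obtain ⟨l, hl, h1, h2⟩ := h σ hσ hAσ
  refine ⟨l, Finset.mem_erase.2 ⟨?_, hl⟩, h1, h2⟩
  rintro rfl
  simp at h1

/-- `x`-pivot with `a x = false`: a premise of type `A` containing the (false) literal `x`
passes its invariant to the premise minus `x`. [cite: Pudlak1997, Thm. 1 (proof)] -/
theorem SemA.erase_pos_inl {D : Finset (Literal (X ⊕ (Y ⊕ Z)))} (h : SemA A a D) {x : X}
    (hx : a x = false) : SemA A a (D.erase (Sum.inl x, true)) := by
  intro σ hσ hAσ
  obtain ⟨l, hl, h1, h2⟩ := h σ hσ hAσ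
  refine ⟨l, Finset.mem_erase.2 ⟨?_, hl⟩, h1, h2⟩
  rintro rfl
  simp [Literal.eval, hσ x, hx] at h2

/-- `x`-pivot with `a x = false`: a premise of type `B` containing the (false) literal `x`
passes its invariant to the premise minus `x`. [cite: Pudlak1997, Thm. 1 (proof)] -/
theorem SemB.erase_pos_inl {D : Finset (Literal (X ⊕ (Y ⊕ Z)))} (h : SemB B a D) {x : X}
    (hx : a x = false) : SemB B a (D.erase (Sum.inl x, true)) := by
  intro σ hσ hBσ
  obtain ⟨l, hl, h1, h2⟩ := h σ hσ hBσ
  refine ⟨l, Finset.mem_erase.2 ⟨?_, hl⟩, h1, h2⟩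
  rintro rfl
  simp [Literal.eval, hσ x, hx] at h2

/-- `x`-pivot with `a x = true`: a premise of type `B` containing the (false) literal `¬x`
passes its invariant to the premise minus `¬x`. [cite: Pudlak1997, Thm. 1 (proof)] -/
theorem SemB.erase_neg_inl {D : Finset (Literal (X ⊕ (Y ⊕ Z)))} (h : SemB B a D) {x : X}
    (hx : a x = true) : SemB B a (D.erase (Sum.inl x, false)) := by
  intro σ hσ hBσ
  obtain ⟨l, hl, h1, h2⟩ := h σ hσ hBσ
  refine ⟨l, Finset.mem_erase.2 ⟨?_, hl⟩, h1, h2⟩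
  rintro rfl
  simp [Literal.eval, hσ x, hx] at h2

/-- `y`-pivot, premise of type `B`: a `y`-literal never counts on the `B`-side.
[cite: Pudlak1997, Thm. 1 (proof)] -/
theorem SemB.erase_inr_inl {D : Finset (Literal (X ⊕ (Y ⊕ Z)))} (h : SemB B a D) (y : Y)
    (b : Bool) : SemB B a (D.erase (Sum.inr (Sum.inl y), b)) := by
  intro σ hσ hBσ
  obtain ⟨l, hl, h1, h2⟩ := h σ hσ hBσ
  refine ⟨l, Finset.mem_erase.2 ⟨?_, hl⟩, h1, h2⟩
  rintro rfl
  simp at h1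

/-- `z`-pivot, premise of type `A`: a `z`-literal never counts on the `A`-side.
[cite: Pudlak1997, Thm. 1 (proof)] -/
theorem SemA.erase_inr_inr {D : Finset (Literal (X ⊕ (Y ⊕ Z)))} (h : SemA A a D) (z : Z)
    (b : Bool) : SemA A a (D.erase (Sum.inr (Sum.inr z), b)) := by
  intro σ hσ hAσ
  obtain ⟨l, hl, h1, h2⟩ := h σ hσ hAσ
  refine ⟨l, Finset.mem_erase.2 ⟨?_, hl⟩, h1, h2⟩
  rintro rfl
  simp at h1

/-- `y`-pivot with both premises of type `A`: soundness of the resolution rule for the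
`A`-side invariant. [cite: Pudlak1997, Thm. 1 (proof)] -/
theorem SemA.resolve {D₁ D₂ : Finset (Literal (X ⊕ (Y ⊕ Z)))} (h₁ : SemA A a D₁) (h₂ : SemA A a D₂)
    (v : X ⊕ (Y ⊕ Z)) : SemA A a (D₁.erase (v, true) ∪ D₂.erase (v, false)) := by
  intro σ hσ hAσ
  obtain ⟨l₁, hl₁, h11, h12⟩ := h₁ σ hσ hAσ
  obtain ⟨l₂, hl₂, h21, h22⟩ := h₂ σ hσ hAσ
  by_cases e₁ : l₁ = (v, true)
  · by_cases e₂ : l₂ = (v, false)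
    · subst e₁; subst e₂
      simp [Literal.eval] at h12 h22
      rw [h12] at h22
      exact absurd h22 (by decide)
    · exact ⟨l₂, Finset.mem_union_right _ (Finset.mem_erase.2 ⟨e₂, hl₂⟩), h21, h22⟩
  · exact ⟨l₁, Finset.mem_union_left _ (Finset.mem_erase.2 ⟨e₁, hl₁⟩), h11, h12⟩

/-- `z`-pivot with both premises of type `B`: soundness of the resolution rule for the
`B`-side invariant. [cite: Pudlak1997, Thm. 1 (proof)] -/
theorem SemB.resolve {D₁ D₂ : Finset (Literal (X ⊕ (Y ⊕ Z)))} (h₁ : SemB B a D₁) (h₂ : SemB B a D₂)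
    (v : X ⊕ (Y ⊕ Z)) : SemB B a (D₁.erase (v, true) ∪ D₂.erase (v, false)) := by
  intro σ hσ hBσ
  obtain ⟨l₁, hl₁, h11, h12⟩ := h₁ σ hσ hBσ
  obtain ⟨l₂, hl₂, h21, h22⟩ := h₂ σ hσ hBσ
  by_cases e₁ : l₁ = (v, true)
  · by_cases e₂ : l₂ = (v, false)
    · subst e₁; subst e₂
      simp [Literal.eval] at h12 h22
      rw [h12] at h22
      exact absurd h22 (by decide)
    · exact ⟨l₂, Finset.mem_union_right _ (Finset.mem_erase.2 ⟨e₂, hl₂⟩), h21, h22⟩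
  · exact ⟨l₁, Finset.mem_union_left _ (Finset.mem_erase.2 ⟨e₁, hl₁⟩), h11, h12⟩

end Semantics

/-! ### The straight-line program: two gates per proof line -/

/-- The wire carrying the type bit of proof line `i` (gate `2 i + 1`). [folklore] -/
def wire (i : ℕ) : X ⊕ ℕ := Sum.inr (2 * i + 1)

/-- The pair of gates attached to proof line `k` (Pudlák 1997, proof of Thm. 1, read as a
straight-line program over `{∧₂, ∨₂, 0, 1}`): constants for initial clauses (`0` for clauses of
`A`, `1` otherwise), a copy for weakenings, `t₁ ∨ t₂` / `t₁ ∧ t₂` for `y`- / `z`-pivots, and the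
monotone selector `t₂ ∧ (x ∨ t₁)` for an `x`-pivot; the second gate of the pair always carries
the type bit of the line. Ill-formed premise indices (impossible in a derivation) give `0`.
[cite: Pudlak1997, Thm. 1 (proof)] -/
def lineGates [DecidableEq X] [DecidableEq Y] [DecidableEq Z] (A : CNF (X ⊕ (Y ⊕ Z)))
    (π : List (ResLine (X ⊕ (Y ⊕ Z)))) (k : ℕ) : Gate X × Gate X :=
  match π[k]? with
  | none => (constGate X false, constGate X false)
  | some l =>
    match l.rule with
    | .initial =>
      (constGate X (!decide (l.clause ∈ A.clauseFinsets)),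
        constGate X (!decide (l.clause ∈ A.clauseFinsets)))
    | .weaken i =>
      if i < k then (andGate (wire i) (wire i), andGate (wire i) (wire i))
      else (constGate X false, constGate X false)
    | .resolve i j v =>
      if i < k ∧ j < k then
        match v with
        | Sum.inl x => (orGate (Sum.inl x) (wire i), andGate (wire j) (Sum.inr (2 * k)))
        | Sum.inr (Sum.inl _) => (orGate (wire i) (wire j), andGate (Sum.inr (2 * k)) (Sum.inr (2 * k)))
        | Sum.inr (Sum.inr _) => (andGate (wire i) (wire j), andGate (Sum.inr (2 * k)) (Sum.inr (2 * k)))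
      else (constGate X false, constGate X false)

section Program

variable [DecidableEq X] [DecidableEq Y] [DecidableEq Z]
variable (A : CNF (X ⊕ (Y ⊕ Z))) (π : List (ResLine (X ⊕ (Y ⊕ Z))))

/-- The gates of the first `n` proof lines. [cite: Pudlak1997, Thm. 1 (proof)] -/
def gatesUpTo (n : ℕ) : List (Gate X) :=
  (List.range n).flatMap fun k => [(lineGates A π k).1, (lineGates A π k).2]

/-- The whole program: two gates per line of `π`. [cite: Pudlak1997, Thm. 1 (proof)] -/
def gates : List (Gate X) := gatesUpTo A π π.length

/-- One more line adds its two gates. [folklore] -/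
theorem gatesUpTo_succ (n : ℕ) :
    gatesUpTo A π (n + 1) = gatesUpTo A π n ++ [(lineGates A π n).1, (lineGates A π n).2] := by
  simp [gatesUpTo, List.range_succ, List.flatMap_append]

/-- The first `n` lines contribute `2 n` gates. [folklore] -/
@[simp] theorem length_gatesUpTo (n : ℕ) : (gatesUpTo A π n).length = 2 * n := by
  induction n with
  | zero => rfl
  | succ n ih => rw [gatesUpTo_succ, List.length_append, ih]; simp; ring

/-- The program has `2 |π|` gates. [folklore] -/
@[simp] theorem length_gates : (gates A π).length = 2 * π.length := length_gatesUpTo A π _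

/-- Splitting the program at line `k < n`. [folklore] -/
theorem gatesUpTo_split {k n : ℕ} (hk : k < n) :
    ∃ R, gatesUpTo A π n = gatesUpTo A π k ++ (lineGates A π k).1 :: (lineGates A π k).2 :: R := by
  induction n with
  | zero => exact absurd hk (Nat.not_lt_zero _)
  | succ n ih =>
    rcases Nat.lt_succ_iff_lt_or_eq.1 hk with h | rfl
    · obtain ⟨R, hR⟩ := ih h
      exact ⟨R ++ [(lineGates A π n).1, (lineGates A π n).2], by
        rw [gatesUpTo_succ, hR]; simp⟩
    · exact ⟨[], gatesUpTo_succ A π k⟩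

/-- The first gate of line `k` only reads earlier lines. [folklore] -/
theorem gateOK_lineGates_fst (k : ℕ) : GateOK (2 * k) (lineGates A π k).1 := by
  unfold lineGates
  rcases π[k]? with _ | l
  · exact gateOK_constGate _ _
  · dsimp only
    rcases l.rule with _ | ⟨i, j, v⟩ | i <;> dsimp only
    · exact gateOK_constGate _ _
    · split_ifs with h
      · rcases v with x | y | z <;> dsimp only
        · refine gateOK_orGate (fun m hm => by cases hm) (fun m hm => ?_)
          simp only [wire, Sum.inr.injEq] at hm; omega
        · refine gateOK_orGate (fun m hm => ?_) (fun m hm => ?_) <;>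
          · simp only [wire, Sum.inr.injEq] at hm; omega
        · refine gateOK_andGate (fun m hm => ?_) (fun m hm => ?_) <;>
          · simp only [wire, Sum.inr.injEq] at hm; omega
      · exact gateOK_constGate _ _
    · split_ifs with h
      · refine gateOK_andGate (fun m hm => ?_) (fun m hm => ?_) <;>
          · simp only [wire, Sum.inr.injEq] at hm; omega
      · exact gateOK_constGate _ _

/-- The second gate of line `k` only reads earlier lines and the first gate of line `k`.
[folklore] -/
theorem gateOK_lineGates_snd (k : ℕ) : GateOK (2 * k + 1) (lineGates A π k).2 := by
  unfold lineGates
  rcases π[k]? with _ | l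
  · exact gateOK_constGate _ _
  · dsimp only
    rcases l.rule with _ | ⟨i, j, v⟩ | i <;> dsimp only
    · exact gateOK_constGate _ _
    · split_ifs with h
      · rcases v with x | y | z <;> dsimp only
        · refine gateOK_andGate (fun m hm => ?_) (fun m hm => ?_)
          · simp only [wire, Sum.inr.injEq] at hm; omega
          · simp only [Sum.inr.injEq] at hm; omega
        · refine gateOK_andGate (fun m hm => ?_) (fun m hm => ?_) <;>
          · simp only [Sum.inr.injEq] at hm; omega
        · refine gateOK_andGate (fun m hm => ?_) (fun m hm => ?_) <;>
          · simp only [Sum.inr.injEq] at hm; omega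
      · exact gateOK_constGate _ _
    · split_ifs with h
      · refine gateOK_andGate (fun m hm => ?_) (fun m hm => ?_) <;>
          · simp only [wire, Sum.inr.injEq] at hm; omega
      · exact gateOK_constGate _ _

/-- The program is well formed. [folklore] -/
theorem wf_gatesUpTo (n : ℕ) : WF (gatesUpTo A π n) := by
  induction n with
  | zero => exact WF.nil
  | succ n ih =>
    rw [gatesUpTo_succ,
      show gatesUpTo A π n ++ [(lineGates A π n).1, (lineGates A π n).2]
        = (gatesUpTo A π n ++ [(lineGates A π n).1]) ++ [(lineGates A π n).2] by simp]
    refine (ih.append_singleton ?_).append_singleton ?_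
    · simpa using gateOK_lineGates_fst A π n
    · simpa using gateOK_lineGates_snd A π n

/-- Both gates of a line are drawn from `{∧₂, ∨₂, 0, 1}`. [folklore] -/
theorem lineGates_mem_monotoneBasis01 (k : ℕ) :
    (lineGates A π k).1.fn ∈ monotoneBasis01 ∧ (lineGates A π k).2.fn ∈ monotoneBasis01 := by
  have hc : ∀ b, (constGate X b).fn ∈ monotoneBasis01 := fun b => by
    rw [constGate_fn]
    cases b
    · exact Set.mem_insert_of_mem _ (Set.mem_insert _ _)
    · exact Set.mem_insert _ _
  have ha : ∀ u v : X ⊕ ℕ, (andGate u v).fn ∈ monotoneBasis01 := fun u v =>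
    monotoneBasis_subset_monotoneBasis01 (by rw [andGate_fn]; exact and_mem_monotoneBasis)
  have ho : ∀ u v : X ⊕ ℕ, (orGate u v).fn ∈ monotoneBasis01 := fun u v =>
    monotoneBasis_subset_monotoneBasis01 (by rw [orGate_fn]; exact or_mem_monotoneBasis)
  unfold lineGates
  rcases π[k]? with _ | l
  · exact ⟨hc _, hc _⟩
  · dsimp only
    rcases l.rule with _ | ⟨i, j, v⟩ | i <;> dsimp only
    · exact ⟨hc _, hc _⟩
    · split_ifs with h
      · rcases v with x | y | z <;> dsimp only
        · exact ⟨ho _ _, ha _ _⟩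
        · exact ⟨ho _ _, ha _ _⟩
        · exact ⟨ha _ _, ha _ _⟩
      · exact ⟨hc _, hc _⟩
    · split_ifs with h
      · exact ⟨ha _ _, ha _ _⟩
      · exact ⟨hc _, hc _⟩

/-- Every gate of the program is drawn from `{∧₂, ∨₂, 0, 1}`. [folklore] -/
theorem gates_mem_monotoneBasis01 : ∀ g ∈ gates A π, g.fn ∈ monotoneBasis01 := by
  intro g hg
  simp only [gates, gatesUpTo, List.mem_flatMap, List.mem_range, List.mem_cons,
    List.not_mem_nil, or_false] at hg
  obtain ⟨k, -, rfl | rfl⟩ := hg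
  · exact (lineGates_mem_monotoneBasis01 A π k).1
  · exact (lineGates_mem_monotoneBasis01 A π k).2

/-! ### The type bits as gate values -/

/-- The TYPE BIT of proof line `k` under the shared assignment `a`: the value of gate
`2 k + 1` of the program (`false` = `A`-side, `true` = `B`-side).
[cite: Pudlak1997, Thm. 1 (proof)] -/
def tv (a : X → Bool) (k : ℕ) : Bool :=
  wireOf a (vals (gates A π) a) (wire k)

/-- The INTERPOLANT: the type bit of the first empty clause of `π` (junk `wire 0` if there is
none). [cite: Pudlak1997, Thm. 1] -/
def interp (a : X → Bool) : Bool :=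
  tv A π a (π.findIdx fun l => decide (l.clause = ∅))

variable {A π}

/-- Values of earlier type bits are read correctly from the prefix program. [folklore] -/
theorem wireOf_gatesUpTo_wire (a : X → Bool) {i k : ℕ} (hik : i < k) (hk : k ≤ π.length) :
    wireOf a (vals (gatesUpTo A π k) a) (wire i) = tv A π a i := by
  unfold tv gates
  rcases hk.lt_or_eq with hlt | rfl
  · obtain ⟨R, hR⟩ := gatesUpTo_split A π hlt
    rw [hR, wireOf_vals_append]
    intro m hm
    simp only [wire, Sum.inr.injEq] at hm
    simp only [length_gatesUpTo]; omega
  · rfl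

/-- Same, for the prefix program extended by the first gate of line `k`. [folklore] -/
theorem wireOf_gatesUpTo_fst_wire (a : X → Bool) {i k : ℕ} (hik : i < k) (hk : k < π.length) :
    wireOf a (vals (gatesUpTo A π k ++ [(lineGates A π k).1]) a) (wire i) = tv A π a i := by
  rw [wireOf_vals_append _ _ _ _ (fun m hm => by
    simp only [wire, Sum.inr.injEq] at hm; simp only [length_gatesUpTo]; omega)]
  exact wireOf_gatesUpTo_wire a hik hk.le

/-- The value of the first gate of line `k`. [folklore] -/
theorem getD_gates_two_mul (a : X → Bool) {k : ℕ} (hk : k < π.length) :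
    (vals (gates A π) a).getD (2 * k) false =
      (lineGates A π k).1.op fun b => wireOf a (vals (gatesUpTo A π k) a) ((lineGates A π k).1.args b) := by
  obtain ⟨R, hR⟩ := gatesUpTo_split A π hk
  unfold gates
  rw [hR, ← length_gatesUpTo A π k, getD_vals_append_cons]

/-- The value of the second gate of line `k`, i.e. the type bit `tv … k`. [folklore] -/
theorem tv_eq_op (a : X → Bool) {k : ℕ} (hk : k < π.length) :
    tv A π a k = (lineGates A π k).2.op fun b =>
      wireOf a (vals (gatesUpTo A π k ++ [(lineGates A π k).1]) a) ((lineGates A π k).2.args b) := by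
  obtain ⟨R, hR⟩ := gatesUpTo_split A π hk
  have hlen : (gatesUpTo A π k ++ [(lineGates A π k).1]).length = 2 * k + 1 := by simp
  unfold tv gates
  rw [wire, wireOf_inr, hR,
    show gatesUpTo A π k ++ (lineGates A π k).1 :: (lineGates A π k).2 :: R
      = (gatesUpTo A π k ++ [(lineGates A π k).1]) ++ (lineGates A π k).2 :: R by simp,
    ← hlen, getD_vals_append_cons]

/-- The first gate of line `k`, read from the extended prefix. [folklore] -/
theorem wireOf_gatesUpTo_fst_self (a : X → Bool) (k : ℕ) :
    wireOf a (vals (gatesUpTo A π k ++ [(lineGates A π k).1]) a) (Sum.inr (2 * k)) =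
      (lineGates A π k).1.op fun b => wireOf a (vals (gatesUpTo A π k) a) ((lineGates A π k).1.args b) := by
  rw [wireOf_inr, ← length_gatesUpTo A π k, vals_append_singleton,
    List.getD_eq_getElem?_getD, List.getElem?_append_right (by simp), length_vals, Nat.sub_self]
  simp

/-- Type bit of an initial line: `false` iff the clause is a clause of `A`.
[cite: Pudlak1997, Thm. 1 (proof)] -/
theorem tv_initial (a : X → Bool) {k : ℕ} (hk : k < π.length) (hr : (π[k]'hk).rule = .initial) :
    tv A π a k = !decide ((π[k]'hk).clause ∈ A.clauseFinsets) := by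
  have h2 : (lineGates A π k).2 = constGate X (!decide ((π[k]'hk).clause ∈ A.clauseFinsets)) := by
    unfold lineGates; rw [List.getElem?_eq_getElem hk]; simp [hr]
  rw [tv_eq_op a hk, h2]
  rfl

/-- Type bit of a weakening line: a copy of the premise's bit.
[cite: Pudlak1997, Thm. 1 (proof)] -/
theorem tv_weaken (a : X → Bool) {k : ℕ} (hk : k < π.length) {i : ℕ} (hr : (π[k]'hk).rule = .weaken i)
    (hi : i < k) : tv A π a k = tv A π a i := by
  have h2 : (lineGates A π k).2 = andGate (wire i) (wire i) := by
    unfold lineGates; rw [List.getElem?_eq_getElem hk]; simp [hr, hi]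
  rw [tv_eq_op a hk, h2, andGate_op, wireOf_gatesUpTo_fst_wire a hi hk, Bool.and_self]

/-- Type bit of a resolution step on a shared pivot `x`: the monotone selector
`t₂ ∧ (a x ∨ t₁)`. [cite: Pudlak1997, Thm. 1 (proof)] -/
theorem tv_resolve_inl (a : X → Bool) {k : ℕ} (hk : k < π.length) {i j : ℕ} {x : X}
    (hr : (π[k]'hk).rule = .resolve i j (Sum.inl x)) (hi : i < k) (hj : j < k) :
    tv A π a k = (tv A π a j && (a x || tv A π a i)) := by
  rw [tv_eq_op a hk]
  have h1 : (lineGates A π k).1 = orGate (Sum.inl x) (wire i) := by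
    unfold lineGates; rw [List.getElem?_eq_getElem hk]; simp [hr, hi, hj]
  have h2 : (lineGates A π k).2 = andGate (wire j) (Sum.inr (2 * k)) := by
    unfold lineGates; rw [List.getElem?_eq_getElem hk]; simp [hr, hi, hj]
  rw [h2, andGate_op, wireOf_gatesUpTo_fst_wire a hj hk, wireOf_gatesUpTo_fst_self a k, h1,
    orGate_op, wireOf_inl, wireOf_gatesUpTo_wire a hi hk.le]

/-- Type bit of a resolution step on a `y`-pivot: `t₁ ∨ t₂`.
[cite: Pudlak1997, Thm. 1 (proof)] -/
theorem tv_resolve_inr_inl (a : X → Bool) {k : ℕ} (hk : k < π.length) {i j : ℕ} {y : Y}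
    (hr : (π[k]'hk).rule = .resolve i j (Sum.inr (Sum.inl y))) (hi : i < k) (hj : j < k) :
    tv A π a k = (tv A π a i || tv A π a j) := by
  rw [tv_eq_op a hk]
  have h1 : (lineGates A π k).1 = orGate (wire i) (wire j) := by
    unfold lineGates; rw [List.getElem?_eq_getElem hk]; simp [hr, hi, hj]
  have h2 : (lineGates A π k).2 = andGate (Sum.inr (2 * k)) (Sum.inr (2 * k)) := by
    unfold lineGates; rw [List.getElem?_eq_getElem hk]; simp [hr, hi, hj]
  rw [h2, andGate_op, Bool.and_self, wireOf_gatesUpTo_fst_self a k, h1, orGate_op,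
    wireOf_gatesUpTo_wire a hi hk.le, wireOf_gatesUpTo_wire a hj hk.le]

/-- Type bit of a resolution step on a `z`-pivot: `t₁ ∧ t₂`.
[cite: Pudlak1997, Thm. 1 (proof)] -/
theorem tv_resolve_inr_inr (a : X → Bool) {k : ℕ} (hk : k < π.length) {i j : ℕ} {z : Z}
    (hr : (π[k]'hk).rule = .resolve i j (Sum.inr (Sum.inr z))) (hi : i < k) (hj : j < k) :
    tv A π a k = (tv A π a i && tv A π a j) := by
  rw [tv_eq_op a hk]
  have h1 : (lineGates A π k).1 = andGate (wire i) (wire j) := by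
    unfold lineGates; rw [List.getElem?_eq_getElem hk]; simp [hr, hi, hj]
  have h2 : (lineGates A π k).2 = andGate (Sum.inr (2 * k)) (Sum.inr (2 * k)) := by
    unfold lineGates; rw [List.getElem?_eq_getElem hk]; simp [hr, hi, hj]
  rw [h2, andGate_op, Bool.and_self, wireOf_gatesUpTo_fst_self a k, h1, andGate_op,
    wireOf_gatesUpTo_wire a hi hk.le, wireOf_gatesUpTo_wire a hj hk.le]

/-! ### The invariant -/

/-- **The splitting invariant** (Pudlák 1997, proof of Thm. 1): along a resolution derivation
from `A ++ B` (shared variables positive in `A`), a line of type bit `false` satisfies the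
`A`-side invariant and a line of type bit `true` the `B`-side invariant.
[cite: Pudlak1997, Thm. 1 (proof)] -/
theorem tv_invariant {B : CNF (X ⊕ (Y ⊕ Z))} (hA : ∀ c ∈ A, ∀ l ∈ c, cntA l = true)
    (hB : ∀ c ∈ B, ∀ l ∈ c, cntB l = true) (hπ : IsResDerivation (A ++ B) π) (a : X → Bool)
    (k : ℕ) (hk : k < π.length) :
    (tv A π a k = false → SemA A a (π[k]'hk).clause) ∧
      (tv A π a k = true → SemB B a (π[k]'hk).clause) := by
  induction k using Nat.strong_induction_on with
  | _ k ih =>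
    have hval := hπ k hk
    have htk : (π.take k).length = k := by simp; omega
    unfold IsValidResLine at hval
    -- case analysis on the rule of line `k`
    rcases hr : (π[k]'hk).rule with _ | ⟨i, j, v⟩ | i
    · -- initial clause
      rw [hr] at hval
      rw [tv_initial a hk hr]
      by_cases hmem : (π[k]'hk).clause ∈ A.clauseFinsets
      · simp only [hmem, decide_true, Bool.not_true, Bool.false_eq_true, false_implies, and_true,
          forall_const]
        exact semA_initial hA hmem
      · simp only [hmem, decide_false, Bool.not_false, forall_const, Bool.true_eq_false,
          false_implies, true_and]
        have hmem' : (π[k]'hk).clause ∈ B.clauseFinsets := by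
          have h := hval
          simp only [CNF.clauseFinsets, List.map_append, List.mem_append] at h hmem ⊢
          exact h.resolve_left hmem
        exact semB_initial hB hmem'
    · -- resolution step
      rw [hr] at hval
      obtain ⟨hi, hj, hres⟩ := hval
      rw [htk] at hi hj
      have hpi : (π.take k)[i]'(by rw [htk]; exact hi) = π[i]'(hi.trans hk) := List.getElem_take
      have hpj : (π.take k)[j]'(by rw [htk]; exact hj) = π[j]'(hj.trans hk) := List.getElem_take
      rw [hpi, hpj] at hres
      obtain ⟨hvi, hvj, hE⟩ := hres
      obtain ⟨ihiA, ihiB⟩ := ih i hi (hi.trans hk)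
      obtain ⟨ihjA, ihjB⟩ := ih j hj (hj.trans hk)
      rw [hE]
      rcases v with x | y | z
      · -- shared pivot
        rw [tv_resolve_inl a hk hr hi hj]
        constructor
        · intro h
          -- `t₂ ∧ (a x ∨ t₁) = false`
          cases htj : tv A π a j
          · -- `t₂ = false`: type `A` via premise `j` minus `¬x`
            exact ((ihjA htj).erase_neg_inl x).mono Finset.subset_union_right
          · rw [htj, Bool.true_and, Bool.or_eq_false_iff] at h
            exact ((ihiA h.2).erase_pos_inl h.1).mono Finset.subset_union_left
        · intro h
          rw [Bool.and_eq_true, Bool.or_eq_true] at h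
          cases hx : a x
          · rw [hx] at h
            have h1 : tv A π a i = true := by simpa using h.2
            exact ((ihiB h1).erase_pos_inl hx).mono Finset.subset_union_left
          · exact ((ihjB h.1).erase_neg_inl hx).mono Finset.subset_union_right
      · -- `y`-pivot
        rw [tv_resolve_inr_inl a hk hr hi hj]
        constructor
        · intro h
          rw [Bool.or_eq_false_iff] at h
          exact (ihiA h.1).resolve (ihjA h.2) _
        · intro h
          rw [Bool.or_eq_true] at h
          rcases h with h | h
          · exact ((ihiB h).erase_inr_inl y true).mono Finset.subset_union_left
          · exact ((ihjB h).erase_inr_inl y false).mono Finset.subset_union_right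
      · -- `z`-pivot
        rw [tv_resolve_inr_inr a hk hr hi hj]
        constructor
        · intro h
          rw [Bool.and_eq_false_iff] at h
          rcases h with h | h
          · exact ((ihiA h).erase_inr_inr z true).mono Finset.subset_union_left
          · exact ((ihjA h).erase_inr_inr z false).mono Finset.subset_union_right
        · intro h
          rw [Bool.and_eq_true] at h
          exact (ihiB h.1).resolve (ihjB h.2) _
    · -- weakening
      rw [hr] at hval
      obtain ⟨hi, hsub⟩ := hval
      rw [htk] at hi
      have hpi : (π.take k)[i]'(by rw [htk]; exact hi) = π[i]'(hi.trans hk) := List.getElem_take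
      rw [hpi] at hsub
      obtain ⟨ihiA, ihiB⟩ := ih i hi (hi.trans hk)
      rw [tv_weaken a hk hr hi]
      exact ⟨fun h => (ihiA h).mono hsub, fun h => (ihiB h).mono hsub⟩

/-- The interpolant decides which side is refuted: `false` refutes `A(a, ·)`, `true` refutes
`B(a, ·)`. [cite: Pudlak1997, Thm. 1] -/
theorem interp_correct {B : CNF (X ⊕ (Y ⊕ Z))} (hA : ∀ c ∈ A, ∀ l ∈ c, cntA l = true)
    (hB : ∀ c ∈ B, ∀ l ∈ c, cntB l = true) (hπ : IsResRefutation (A ++ B) π) (a : X → Bool) :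
    (interp A π a = false → ¬ SatOver A a) ∧ (interp A π a = true → ¬ SatOver B a) := by
  obtain ⟨hder, l, hl, hle⟩ := hπ
  set e := π.findIdx fun l => decide (l.clause = ∅) with he
  have hex : ∃ l ∈ π, (fun l : ResLine (X ⊕ (Y ⊕ Z)) => decide (l.clause = ∅)) l = true :=
    ⟨l, hl, by simp [hle]⟩
  have helt : e < π.length := List.findIdx_lt_length_of_exists hex
  have hemp : (π[e]'helt).clause = ∅ := by
    have := List.findIdx_getElem (w := helt)
    simpa using this
  obtain ⟨h1, h2⟩ := tv_invariant hA hB hder a e helt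
  rw [hemp] at h1 h2
  exact ⟨fun h => (h1 h).not_satOver, fun h => (h2 h).not_satOver⟩

/-- The interpolant is a wire of a program over `{∧₂, ∨₂, 0, 1}` with `2 |π|` gates, hence
constant or computed by a monotone circuit with at most `2 |π|` gates.
[cite: Pudlak1997, Thm. 1] -/
theorem interp_const_or_circuit (hπ : ∃ l ∈ π, l.clause = ∅) :
    (∃ b, ∀ a, interp A π a = b) ∨
      ∃ C : Circuit X, C.IsOver monotoneBasis ∧ C.size ≤ 2 * π.length ∧
        ∀ a, C.eval a = interp A π a := by
  obtain ⟨l, hl, hle⟩ := hπ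
  have hex : ∃ l ∈ π, (fun l : ResLine (X ⊕ (Y ⊕ Z)) => decide (l.clause = ∅)) l = true :=
    ⟨l, hl, by simp [hle]⟩
  have helt : (π.findIdx fun l => decide (l.clause = ∅)) < π.length :=
    List.findIdx_lt_length_of_exists hex
  have h := const_or_exists_monotone_circuit (gates A π)
    (wire (π.findIdx fun l => decide (l.clause = ∅))) (wf_gatesUpTo A π _)
    (gates_mem_monotoneBasis01 A π) (fun m hm => by
      simp only [wire, Sum.inr.injEq] at hm; rw [length_gates]; omega)
  rw [length_gates] at h
  exact h

end Program

end ResInterpolant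

open ResInterpolant

/-- **Feasible monotone interpolation for resolution** (Krajíček 1997, Thm. 6.1; Pudlák 1997,
Thm. 1). Let `A(x, y)` and `B(x, z)` be CNFs over the variables `X ⊕ (Y ⊕ Z)` such that the
clauses of `A` contain only POSITIVE shared literals and `y`-literals, and the clauses of `B`
only shared literals and `z`-literals, and let `π` be a resolution refutation of `A ++ B`. Then
there is an interpolant `I : (X → Bool) → Bool` with `I a = false ⇒ A(a, ·)` unsatisfiable and
`I a = true ⇒ B(a, ·)` unsatisfiable, which is constant or computed by a circuit over the
monotone basis `{∧₂, ∨₂}` with at most `2 |π|` gates.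
[cite: Pudlak1997, Thm. 1] [cite: Krajicek1997, Thm. 6.1] -/
theorem resolution_monotone_interpolation [DecidableEq X] [DecidableEq Y] [DecidableEq Z]
    (A B : CNF (X ⊕ (Y ⊕ Z))) (hA : ∀ c ∈ A, ∀ l ∈ c, cntA l = true)
    (hB : ∀ c ∈ B, ∀ l ∈ c, cntB l = true) {π : List (ResLine (X ⊕ (Y ⊕ Z)))}
    (hπ : IsResRefutation (A ++ B) π) :
    ∃ I : (X → Bool) → Bool,
      (∀ a, I a = false → ¬ SatOver A a) ∧ (∀ a, I a = true → ¬ SatOver B a) ∧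
      ((∃ b, ∀ a, I a = b) ∨
        ∃ C : Circuit X, C.IsOver monotoneBasis ∧ C.size ≤ 2 * π.length ∧ C.Computes I) := by
  refine ⟨interp A π, fun a => (interp_correct hA hB hπ a).1, fun a => (interp_correct hA hB hπ a).2,
    ?_⟩
  rcases interp_const_or_circuit (A := A) hπ.2 with h | ⟨C, hC, hs, hCe⟩
  · exact Or.inl h
  · exact Or.inr ⟨C, hC, hs, hCe⟩

/-- **Feasible monotone interpolation for resolution, circuit form** (Krajíček 1997, Thm. 6.1;
Pudlák 1997, Thm. 1): if moreover `A(a₀, ·)` is satisfiable for some `a₀` and `B(a₁, ·)` for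
some `a₁` (so that the interpolant is not constant), the interpolant is a MONOTONE Boolean
function computed by a circuit over `{∧₂, ∨₂}` with at most `2 |π|` gates; in particular every
lower bound for monotone circuits separating `{a | A(a,·) satisfiable}` from
`{a | B(a,·) satisfiable}` is a lower bound for `|π| / 2`.
[cite: Pudlak1997, Thm. 1] [cite: Krajicek1997, Thm. 6.1] -/
theorem resolution_monotone_interpolation' [DecidableEq X] [DecidableEq Y] [DecidableEq Z]
    (A B : CNF (X ⊕ (Y ⊕ Z))) (hA : ∀ c ∈ A, ∀ l ∈ c, cntA l = true)
    (hB : ∀ c ∈ B, ∀ l ∈ c, cntB l = true) {a₀ a₁ : X → Bool} (hA₀ : SatOver A a₀)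
    (hB₁ : SatOver B a₁) {π : List (ResLine (X ⊕ (Y ⊕ Z)))} (hπ : IsResRefutation (A ++ B) π) :
    ∃ I : (X → Bool) → Bool, Monotone I ∧
      (∀ a, SatOver A a → I a = true) ∧ (∀ a, SatOver B a → I a = false) ∧
      ∃ C : Circuit X, C.IsOver monotoneBasis ∧ C.size ≤ 2 * π.length ∧ C.Computes I := by
  obtain ⟨I, hIA, hIB, h⟩ := resolution_monotone_interpolation A B hA hB hπ
  have hIA' : ∀ a, SatOver A a → I a = true := fun a ha => by
    cases hI : I a
    · exact absurd ha (hIA a hI)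
    · rfl
  have hIB' : ∀ a, SatOver B a → I a = false := fun a hb => by
    cases hI : I a
    · rfl
    · exact absurd hb (hIB a hI)
  rcases h with ⟨b, hb⟩ | ⟨C, hC, hs, hCe⟩
  · exfalso
    have h0 := hIA' a₀ hA₀
    have h1 := hIB' a₁ hB₁
    rw [hb] at h0 h1
    rw [h0] at h1
    exact Bool.noConfusion h1
  · refine ⟨I, ?_, hIA', hIB', C, hC, hs, hCe⟩
    have hm := C.monotone_eval_of_isOver_monotoneBasis hC
    intro u v huv
    have := hm huv
    rwa [hCe u, hCe v] at this

end Literature.Computability.MetaComplexity
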